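import Literature.NumberTheory.Rogawski1990.LocalEndoscopicChartDatumCM      -- ★ `isOpen_setOf_isLocalGRegular` (the `G`-regular locus of `H_v` is open, non-split place); brings ★ `LocalTransfer` (`IsLocalGRegular`, `endoEmbLocal`)
import Literature.NumberTheory.Automorphic.StableCentralizerEquivCM           -- ★ `commute_of_commute_of_isRegularElt_local` (the matrix commutant of a regular element of `U(H)(L⁺_v)` is commutative)
import HarnessLib

/-!
# F0 · P3c · crux H413 — road «UP-TR», brick (H3b) «CARTAN-FIELDS-H»: the Cartan subgroup `Z_H(γ₀)` of a `G`-regular `γ₀ ∈ H_v = U(Φ₂)(L⁺_v) × U(Φ₁)(L⁺_v)`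
# is abelian, closed and self-centralising at its `G`-regular elements; the `G`-regular locus is Borel [Rogawski1990, §3.1 p. 19, §4.3 p. 42, §12.5 pp. 182–183]

Cell `pub/hodgecm-mathlib`, crux H413 = `stmt-HodgeConjecture-24833` (lane `--supports …`, count-neutral), route HCCMUnconditional; seat LH4-p01 (g8), brick (H3b) of
road «UP-TR» (`F0/P3/F0P3-p02/g23/ROAD-UP-TR.v1.F0P3p02g23.md` §3, holder F0P3-p02 (g23); LEAD T14-21).  THEOREMS ONLY (no definition ∕ instance ∕ notation ∕ named
fact ∕ `sorry`); ★-only imports.  The `H_v`-twin of §1 + §2 (first heads) of ★ RADIAL-G `Theorems/F0P3cStCharTSWeylCartanRadial` (there: `Gqs L v = U(Φ₃)(L⁺_v)` and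
`IsRegularElt`; here: `H_v` and ★ `IsLocalGRegular L v` = «`ι_v(γ_H)` is regular semisimple in `GL₃(∏_{w ∣ v} L_w)`», ★ `endoEmbLocal`).

WHAT (letters of the road file §2: `H_v := (cmDatum L 2 Φ₂).Local v × (cmDatum L 1 Φ₁).Local v`, `R_H := IsLocalGRegular L v`, `T = Subgroup.centralizer {γ₀}`).
* `mul_eq_mul_iff_commute_endoEmbLocal` — `a b = b a` in `H_v` iff the matrices `ι_v a`, `ι_v b ∈ M₃(∏_{w ∣ v} L_w)` commute (`ι_v` is an injective homomorphism).
* `centralizer_eq_of_mem_centralizer_of_isLocalGRegular` — **`Z_H(t) = Z_H(γ₀)` for every `G`-regular `t ∈ Z_H(γ₀)`** (`γ₀` `G`-regular), PLACE-FREE: both `ι_v t` and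
  `ι_v γ₀` are regular, so their matrix commutants are commutative (★ `commute_of_commute_of_isRegularElt_local` at `N = 3`) and contain each other's generator.
  (The tree had this only at a SPLIT place, ★ `WeylVanishingSplitTorusAxioms.centralizer_eq_of_mem_of_isLocalGRegular`, via `localSplitEquiv`; road «UP-TR» lives at
  the NON-SPLIT places.)  The engine hypothesis `hRT` of ★ `exists_radialMeasure_lintegral_conjFamily` at `R = R_H`.
* `isClosed_coe_centralizer`, `isOpen_setOf_isLocalGRegular_of_forall` ∕ `measurableSet_setOf_isLocalGRegular` — `Z_H(γ₀)` is closed; the `G`-regular locus is open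
  (★ `isOpen_setOf_isLocalGRegular`, here under the road's binder `hns : ∀ w ∣ v, c • w = w`) hence Borel.
* §2, Cartan-packaged under `hT : T = Subgroup.centralizer {γ₀}` (the shape ★ RADIAL-G §2 consumes): `isClosed_cartan`, `centralizer_eq_cartan_of_isLocalGRegular`,
  `centralizer_eq_centralizer_of_mem_cartan`, `mul_eq_mul_of_mem_cartan` (the abelian clause `∀ a ∈ T, ∀ b ∈ T, a * b = b * a` is ★ `centralizer_comm_of_isLocalGRegular` after
  `subst hT` — cited, not restated; the gate's dedup identifies its `T`-packaged form with ★ RADIAL-G `mul_comm_cartan`).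
CITED, NOT RESTATED (dedup): «`Z_H(γ₀)` is abelian» = ★ `UnitaryGroup.centralizer_comm_of_isLocalGRegular` (`Automorphic/LocalOrbitalMeasureRegular`); «`R_H` is a class
function» = ★ `isLocalGRegular_conj_iff` (`Rogawski1990/UnitFundamentalLemmaInertLeviClause`), ★ `isLocalGRegular_of_isConj` (`GRegularLocalisation`), ★
`isLocalGRegular_iff_of_isLocalStablyConjH` (`Theorems/F0P3cStCharTSStableInvariantsH`); «`R_H` open» = ★ `isOpen_setOf_isLocalGRegular` (`LocalEndoscopicChartDatumCM`).
HONEST LABEL.  Count-neutral helper (substrate of (H3c) RADIAL-H ∕ (H3d) ORBINT-H ∕ (H5) WIF-H of road «UP-TR»; closes no organ).  HC_CM is proved only modulo the 7 printed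
citations (2 remaining named inputs: hLiu418 = `stmt-HodgeConjecture-24832`, h413 = `stmt-HodgeConjecture-24833`) until rung 0 closes.

## References
* [Rogawski1990] J. D. Rogawski, *Automorphic Representations of Unitary Groups in Three Variables*, Ann. of Math. Stud. 123 (1990), §3.1 p. 19 (regular elements, Cartan
  subgroups), §4.3 p. 42 (`G`-regular elements of `H`), §4.8 p. 53 (the block embedding), §12.5 pp. 182–183 (the `H`-side of the stabilised trace formula).
* [HarishChandra1970] Harish-Chandra (notes by G. van Dijk), *Harmonic Analysis on Reductive p-adic Groups*, LNM 162 (1970), Lemma 42.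
-/

set_option autoImplicit false
-- the mandated namespace has the single-problem summit's repeated segment (`HodgeConjecture.HodgeConjecture`)
set_option linter.dupNamespace false

noncomputable section

open NumberField IsDedekindDomain MeasureTheory Filter Topology
open scoped Matrix MatrixGroups
open Literature.NumberTheory.Rogawski1990 Literature.NumberTheory.Automorphic Literature.NumberTheory.Automorphic.UnitaryGroup

namespace Summit.HodgeConjecture.HodgeConjecture.Cruxes.H413.F0P3cStCharTSUpTrCartanFields

variable (L : Type) [Field L] [NumberField L] [IsCMField L] (v : HeightOneSpectrum (𝓞 ↥(maximalRealSubfield L)))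

/-! ## §1 The Cartan subgroup `Z_H(γ₀)` of a `G`-regular `γ₀ ∈ H_v`: closed, self-centralising at its `G`-regular elements; the `G`-regular locus is Borel -/

/-- **`G`-regularity read on the matrix carrier**: `IsLocalGRegular L v s` IS «`ι_v s ∈ GL₃(∏_{w ∣ v} L_w)` is regular semisimple» (definitional unfolding of ★ `IsLocalGRegular` ∕
★ `IsGRegular` ∕ ★ `endoEmbLocal`). [cite: Rogawski1990, §4.3 p. 42] -/
theorem isLocalGRegular_iff_isRegularElt_endoEmbLocal
    (s : (cmDatum L 2 (Matrix.of fun i j : Fin 2 => if i.val + j.val + 1 = 2 then (1 : L) else 0)).Local v ×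
      (cmDatum L 1 (Matrix.of fun i j : Fin 1 => if i.val + j.val + 1 = 1 then (1 : L) else 0)).Local v) :
    IsLocalGRegular L v s ↔ IsRegularElt ((endoEmbLocal L v s).val : GL (Fin 3) (LocalRing L v)) :=
  Iff.rfl

/-- **Equality in `H_v` through the block embedding**: `a b = b a ↔` the matrices `ι_v a`, `ι_v b ∈ M₃(∏_{w ∣ v} L_w)` commute (`ι_v` is an injective homomorphism,
★ `endoEmbLocal_injective`). [cite: Rogawski1990, §4.8 p. 53; §3.1 p. 19] -/
theorem mul_eq_mul_iff_commute_endoEmbLocal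
    (a b : (cmDatum L 2 (Matrix.of fun i j : Fin 2 => if i.val + j.val + 1 = 2 then (1 : L) else 0)).Local v ×
      (cmDatum L 1 (Matrix.of fun i j : Fin 1 => if i.val + j.val + 1 = 1 then (1 : L) else 0)).Local v) :
    a * b = b * a ↔
      Commute ((endoEmbLocal L v a).val : GL (Fin 3) (LocalRing L v)).val
        ((endoEmbLocal L v b).val : GL (Fin 3) (LocalRing L v)).val := by
  constructor
  · intro h
    have h' : endoEmbLocal L v a * endoEmbLocal L v b = endoEmbLocal L v b * endoEmbLocal L v a := by
      rw [← map_mul, ← map_mul, h]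
    exact congrArg (fun s : (cmDatum L 3 (Matrix.of fun i j : Fin 3 => if i.val + j.val + 1 = 3 then (1 : L) else 0)).Local v =>
      (s.val : GL (Fin 3) (LocalRing L v)).val) h'
  · intro h
    apply endoEmbLocal_injective L v
    rw [map_mul, map_mul]
    exact Subtype.ext (Units.ext h.eq)

/-- `Z_H(γ₀)` is closed (Mathlib `Set.isClosed_centralizer`). [cite: Rogawski1990, §3.1 p. 19] -/
theorem isClosed_coe_centralizer
    [T2Space ((cmDatum L 2 (Matrix.of fun i j : Fin 2 => if i.val + j.val + 1 = 2 then (1 : L) else 0)).Local v ×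
      (cmDatum L 1 (Matrix.of fun i j : Fin 1 => if i.val + j.val + 1 = 1 then (1 : L) else 0)).Local v)]
    (γ₀ : (cmDatum L 2 (Matrix.of fun i j : Fin 2 => if i.val + j.val + 1 = 2 then (1 : L) else 0)).Local v ×
      (cmDatum L 1 (Matrix.of fun i j : Fin 1 => if i.val + j.val + 1 = 1 then (1 : L) else 0)).Local v) :
    IsClosed ((Subgroup.centralizer ({γ₀} : Set ((cmDatum L 2 (Matrix.of fun i j : Fin 2 => if i.val + j.val + 1 = 2 then (1 : L) else 0)).Local v ×
      (cmDatum L 1 (Matrix.of fun i j : Fin 1 => if i.val + j.val + 1 = 1 then (1 : L) else 0)).Local v)) : Subgroup _) :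
        Set ((cmDatum L 2 (Matrix.of fun i j : Fin 2 => if i.val + j.val + 1 = 2 then (1 : L) else 0)).Local v ×
          (cmDatum L 1 (Matrix.of fun i j : Fin 1 => if i.val + j.val + 1 = 1 then (1 : L) else 0)).Local v)) :=
  Set.isClosed_centralizer _

/-- **`Z_H(t) = Z_H(γ₀)` for every `G`-REGULAR `t ∈ Z_H(γ₀)`** (`γ₀` `G`-regular), at ANY finite place: `ι_v t` and `ι_v γ₀` are regular semisimple in `GL₃(∏_{w ∣ v} L_w)`, so their
matrix commutants are commutative (★ `commute_of_commute_of_isRegularElt_local`, `N = 3`) and each contains the other's generator; read back in `H_v` through the injective `ι_v`.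
The engine hypothesis `hRT` of ★ `exists_radialMeasure_lintegral_conjFamily` at `R = IsLocalGRegular L v`. [cite: Rogawski1990, §3.1 p. 19; §4.3 p. 42] [cite: HarishChandra1970, Lemma 42] -/
theorem centralizer_eq_of_mem_centralizer_of_isLocalGRegular
    {γ₀ : (cmDatum L 2 (Matrix.of fun i j : Fin 2 => if i.val + j.val + 1 = 2 then (1 : L) else 0)).Local v ×
      (cmDatum L 1 (Matrix.of fun i j : Fin 1 => if i.val + j.val + 1 = 1 then (1 : L) else 0)).Local v}
    (hγ₀ : IsLocalGRegular L v γ₀)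
    {t : (cmDatum L 2 (Matrix.of fun i j : Fin 2 => if i.val + j.val + 1 = 2 then (1 : L) else 0)).Local v ×
      (cmDatum L 1 (Matrix.of fun i j : Fin 1 => if i.val + j.val + 1 = 1 then (1 : L) else 0)).Local v}
    (ht : t ∈ Subgroup.centralizer ({γ₀} : Set ((cmDatum L 2 (Matrix.of fun i j : Fin 2 => if i.val + j.val + 1 = 2 then (1 : L) else 0)).Local v ×
      (cmDatum L 1 (Matrix.of fun i j : Fin 1 => if i.val + j.val + 1 = 1 then (1 : L) else 0)).Local v)))
    (htreg : IsLocalGRegular L v t) :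
    Subgroup.centralizer ({t} : Set ((cmDatum L 2 (Matrix.of fun i j : Fin 2 => if i.val + j.val + 1 = 2 then (1 : L) else 0)).Local v ×
        (cmDatum L 1 (Matrix.of fun i j : Fin 1 => if i.val + j.val + 1 = 1 then (1 : L) else 0)).Local v)) =
      Subgroup.centralizer ({γ₀} : Set ((cmDatum L 2 (Matrix.of fun i j : Fin 2 => if i.val + j.val + 1 = 2 then (1 : L) else 0)).Local v ×
        (cmDatum L 1 (Matrix.of fun i j : Fin 1 => if i.val + j.val + 1 = 1 then (1 : L) else 0)).Local v)) := by
  rw [Subgroup.mem_centralizer_singleton_iff] at ht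
  have htc := (mul_eq_mul_iff_commute_endoEmbLocal L v t γ₀).1 ht
  ext x
  rw [Subgroup.mem_centralizer_singleton_iff, Subgroup.mem_centralizer_singleton_iff, mul_eq_mul_iff_commute_endoEmbLocal,
    mul_eq_mul_iff_commute_endoEmbLocal]
  constructor
  · intro hx
    exact commute_of_commute_of_isRegularElt_local L v (endoEmbLocal L v t) htreg _ _ hx htc.symm
  · intro hx
    exact commute_of_commute_of_isRegularElt_local L v (endoEmbLocal L v γ₀) hγ₀ _ _ hx htc

/-- **The `G`-regular locus of `H_v` is OPEN** under the road's non-split binder `hns : ∀ w ∣ v, c • w = w` (★ `isOpen_setOf_isLocalGRegular` at the unique `w ∣ v`).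
[cite: Rogawski1990, §4.3 p. 42] -/
theorem isOpen_setOf_isLocalGRegular_of_forall (hns : ∀ w : PlacesOver L v, IsCMField.complexConj L • w.1 = w.1) :
    IsOpen {s : (cmDatum L 2 (Matrix.of fun i j : Fin 2 => if i.val + j.val + 1 = 2 then (1 : L) else 0)).Local v ×
        (cmDatum L 1 (Matrix.of fun i j : Fin 1 => if i.val + j.val + 1 = 1 then (1 : L) else 0)).Local v | IsLocalGRegular L v s} := by
  obtain ⟨w⟩ := (inferInstance : Nonempty (PlacesOver L v))
  exact isOpen_setOf_isLocalGRegular L w (hns w)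

/-- **The `G`-regular locus of `H_v` is BOREL** (it is open, ★ `isOpen_setOf_isLocalGRegular`), for any Borel structure on `H_v`. [cite: Rogawski1990, §4.3 p. 42; §12.5 p. 182] -/
theorem measurableSet_setOf_isLocalGRegular (hns : ∀ w : PlacesOver L v, IsCMField.complexConj L • w.1 = w.1)
    [MeasurableSpace ((cmDatum L 2 (Matrix.of fun i j : Fin 2 => if i.val + j.val + 1 = 2 then (1 : L) else 0)).Local v ×
      (cmDatum L 1 (Matrix.of fun i j : Fin 1 => if i.val + j.val + 1 = 1 then (1 : L) else 0)).Local v)]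
    [BorelSpace ((cmDatum L 2 (Matrix.of fun i j : Fin 2 => if i.val + j.val + 1 = 2 then (1 : L) else 0)).Local v ×
      (cmDatum L 1 (Matrix.of fun i j : Fin 1 => if i.val + j.val + 1 = 1 then (1 : L) else 0)).Local v)] :
    MeasurableSet {s : (cmDatum L 2 (Matrix.of fun i j : Fin 2 => if i.val + j.val + 1 = 2 then (1 : L) else 0)).Local v ×
        (cmDatum L 1 (Matrix.of fun i j : Fin 1 => if i.val + j.val + 1 = 1 then (1 : L) else 0)).Local v | IsLocalGRegular L v s} :=
  (isOpen_setOf_isLocalGRegular_of_forall L v hns).measurableSet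

/-! ## §2 Cartan-packaged forms: `T = Z_H(γ₀)` with `γ₀` `G`-regular (the shape ★ RADIAL-G §2 consumes, `Gqs L v ↦ H_v`, `IsRegularElt ↦ IsLocalGRegular L v`) -/

section Cartan

variable {L v}
variable {T : Subgroup ((cmDatum L 2 (Matrix.of fun i j : Fin 2 => if i.val + j.val + 1 = 2 then (1 : L) else 0)).Local v ×
      (cmDatum L 1 (Matrix.of fun i j : Fin 1 => if i.val + j.val + 1 = 1 then (1 : L) else 0)).Local v)}
  {γ₀ : (cmDatum L 2 (Matrix.of fun i j : Fin 2 => if i.val + j.val + 1 = 2 then (1 : L) else 0)).Local v ×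
      (cmDatum L 1 (Matrix.of fun i j : Fin 1 => if i.val + j.val + 1 = 1 then (1 : L) else 0)).Local v}
  (hγ₀ : IsLocalGRegular L v γ₀)
  (hT : T = Subgroup.centralizer ({γ₀} : Set ((cmDatum L 2 (Matrix.of fun i j : Fin 2 => if i.val + j.val + 1 = 2 then (1 : L) else 0)).Local v ×
      (cmDatum L 1 (Matrix.of fun i j : Fin 1 => if i.val + j.val + 1 = 1 then (1 : L) else 0)).Local v)))

include hT in
/-- `T = Z_H(γ₀)` is closed. [cite: Rogawski1990, §3.1 p. 19] -/
theorem isClosed_cartan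
    [T2Space ((cmDatum L 2 (Matrix.of fun i j : Fin 2 => if i.val + j.val + 1 = 2 then (1 : L) else 0)).Local v ×
      (cmDatum L 1 (Matrix.of fun i j : Fin 1 => if i.val + j.val + 1 = 1 then (1 : L) else 0)).Local v)] :
    IsClosed (T : Set ((cmDatum L 2 (Matrix.of fun i j : Fin 2 => if i.val + j.val + 1 = 2 then (1 : L) else 0)).Local v ×
      (cmDatum L 1 (Matrix.of fun i j : Fin 1 => if i.val + j.val + 1 = 1 then (1 : L) else 0)).Local v)) := by
  rw [hT]; exact isClosed_coe_centralizer L v γ₀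

include hγ₀ hT in
/-- **`Z_H(t) = T` for every `G`-regular `t ∈ T = Z_H(γ₀)`** (§1 `centralizer_eq_of_mem_centralizer_of_isLocalGRegular`). [cite: Rogawski1990, §3.1 p. 19; §4.3 p. 42]
[cite: HarishChandra1970, Lemma 42] -/
theorem centralizer_eq_cartan_of_isLocalGRegular (t : ↥T)
    (ht : IsLocalGRegular L v (t : (cmDatum L 2 (Matrix.of fun i j : Fin 2 => if i.val + j.val + 1 = 2 then (1 : L) else 0)).Local v ×
      (cmDatum L 1 (Matrix.of fun i j : Fin 1 => if i.val + j.val + 1 = 1 then (1 : L) else 0)).Local v)) :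
    Subgroup.centralizer ({(t : (cmDatum L 2 (Matrix.of fun i j : Fin 2 => if i.val + j.val + 1 = 2 then (1 : L) else 0)).Local v ×
        (cmDatum L 1 (Matrix.of fun i j : Fin 1 => if i.val + j.val + 1 = 1 then (1 : L) else 0)).Local v)} :
        Set ((cmDatum L 2 (Matrix.of fun i j : Fin 2 => if i.val + j.val + 1 = 2 then (1 : L) else 0)).Local v ×
          (cmDatum L 1 (Matrix.of fun i j : Fin 1 => if i.val + j.val + 1 = 1 then (1 : L) else 0)).Local v)) = T := by
  subst hT
  exact centralizer_eq_of_mem_centralizer_of_isLocalGRegular L v hγ₀ t.2 ht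

include hT in
/-- Every element of `T = Z_H(γ₀)` commutes with `γ₀` (bookkeeping). [cite: Rogawski1990, §3.1 p. 19] -/
theorem mul_eq_mul_of_mem_cartan {t : (cmDatum L 2 (Matrix.of fun i j : Fin 2 => if i.val + j.val + 1 = 2 then (1 : L) else 0)).Local v ×
      (cmDatum L 1 (Matrix.of fun i j : Fin 1 => if i.val + j.val + 1 = 1 then (1 : L) else 0)).Local v} (ht : t ∈ T) :
    t * γ₀ = γ₀ * t := by
  subst hT
  exact Subgroup.mem_centralizer_singleton_iff.1 ht

include hγ₀ hT in
/-- **`T` is the centraliser of ANY of its `G`-regular elements, as a subgroup equality `Z_H(t) = Z_H(γ₀)`** (re-basing the Cartan subgroup at `t`). [cite: Rogawski1990, §3.1 p. 19; §4.3 p. 42] -/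
theorem centralizer_eq_centralizer_of_mem_cartan
    {t : (cmDatum L 2 (Matrix.of fun i j : Fin 2 => if i.val + j.val + 1 = 2 then (1 : L) else 0)).Local v ×
      (cmDatum L 1 (Matrix.of fun i j : Fin 1 => if i.val + j.val + 1 = 1 then (1 : L) else 0)).Local v} (ht : t ∈ T) (htreg : IsLocalGRegular L v t) :
    Subgroup.centralizer ({t} : Set ((cmDatum L 2 (Matrix.of fun i j : Fin 2 => if i.val + j.val + 1 = 2 then (1 : L) else 0)).Local v ×
        (cmDatum L 1 (Matrix.of fun i j : Fin 1 => if i.val + j.val + 1 = 1 then (1 : L) else 0)).Local v)) =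
      Subgroup.centralizer ({γ₀} : Set ((cmDatum L 2 (Matrix.of fun i j : Fin 2 => if i.val + j.val + 1 = 2 then (1 : L) else 0)).Local v ×
        (cmDatum L 1 (Matrix.of fun i j : Fin 1 => if i.val + j.val + 1 = 1 then (1 : L) else 0)).Local v)) := by
  subst hT
  exact centralizer_eq_of_mem_centralizer_of_isLocalGRegular L v hγ₀ ht htreg

end Cartan

end Summit.HodgeConjecture.HodgeConjecture.Cruxes.H413.F0P3cStCharTSUpTrCartanFields

end
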